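import Summits.CriticalPhenomena.PercolationContinuityZ3.Theorems.SahiMasterFamilyFCombOneSharedDict

/-!
# SCHEME Σ: the dual-bijection classes (S3), (S5) of `φ` (support file)

Support file (prover seat `prim-bnk-2`, gen 31–32; `--supports stmt-CriticalPhenomena-4575`).  Proof document
`run/shared/lean/prim/prim-l12/prim-bnk-2/PROOF-THEOREM-I1.md` §2 (✓adm) and §3 (injectivity).

(S3): a `T1⁻` unit `((x, y), 0)` with `e ∈ x` has `x_I ∈ c = σP \ Q` (`P = B⁰|_R ⊆ Q = B¹|_R`, `R = I \ (y ∩ I)`) and goes to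
the `T1⁺` unit at `(Φ_c(x_I) ∪ x_J + e, y)`, `Φ_c : c ≅↑ d \ T`; (S5): a `T2⁻` unit with `e ∈ x` has `x_J ∈ c′_w` and goes to the
`T2⁺` unit at `(x_I ∪ Φ′_w(x_J) + e, y)`.  For each class: domain, value of `φ`, the class of the new trace, admissibility
(`phi_adm_S3`, `phi_adm_S5`), signature (`3`, `7`: the new trace is NOT in `T` resp. `T_w`) and injectivity on the class.
No definitions; no `sorry`.
-/

namespace Summit.CriticalPhenomena.PercolationContinuityZ3.Theorems

namespace SahiFComb.Shift

open Finset FinsetFamily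
open scoped Classical

variable {ι : Type*} [Fintype ι] [DecidableEq ι] [LinearOrder ι]

namespace OneShared

variable {S : OneShared ι}

/-! ### Class (S3): `T1⁻` with `e ∈ x` -/

/-- (S3) domain: `x_I ∈ σP \ Q`. [this work] -/
theorem dom_S3 {x y : Finset ι} (hu : ((x, y), 0) ∈ ThreePartition.negUnitSetF S.B S.C) (hex : S.e ∈ x) :
    x ∩ S.I ∈ (secLow (S.I \ (y ∩ S.I)) S.B).image (fun t => (S.I \ (y ∩ S.I)) \ t) \ secHigh (S.I \ (y ∩ S.I)) S.e S.B := by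
  rw [mem_negUnitSetF_iff] at hu
  obtain ⟨hxy, h⟩ := hu
  simp only at hxy h
  rcases h with ⟨-, ⟨-, hxB⟩, hzB⟩ | ⟨h1, -⟩ | ⟨h2, -⟩
  rotate_left
  · exact absurd h1 (by norm_num)
  · exact absurd h2 (by norm_num)
  have hey : S.e ∉ y := fun h => disjoint_left.1 hxy hex h
  have hxIR : x ∩ S.I ⊆ S.I \ (y ∩ S.I) := inter_subset_sdiff_inter hxy S.I
  have hzI : (x ∪ y)ᶜ ∩ S.I = (S.I \ (y ∩ S.I)) \ (x ∩ S.I) := compl_union_inter_eq x y S.I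
  have hez : S.e ∉ (x ∪ y)ᶜ := by rw [mem_compl, not_not, mem_union]; exact Or.inl hex
  have hPR : ∀ s ∈ secLow (S.I \ (y ∩ S.I)) S.B, s ⊆ S.I \ (y ∩ S.I) := fun s hs => (mem_secLow.1 hs).1
  rw [mem_sdiff, mem_image_ground_sdiff _ hPR]
  refine ⟨⟨hxIR, ?_⟩, fun h => hxB ((mem_B_iff_secHigh hex hxIR).2 h)⟩
  rw [← hzI]
  exact (mem_B_iff_secLow hez (hzI ▸ sdiff_subset)).1 hzB

/-- (S3) the value of `φ`. [this work] -/
theorem phi_eq_S3 {x y : Finset ι} (hu : ((x, y), 0) ∈ ThreePartition.negUnitSetF S.B S.C) (hex : S.e ∈ x) :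
    S.phi ((x, y), 0) = (((x \ S.I) ∪ ((S.dataI y).Φc ⟨x ∩ S.I, dom_S3 hu hex⟩ : Finset ι), y), 0) := by
  have hey : S.e ∉ y := fun h => disjoint_left.1 ((mem_negUnitSetF_iff _ _ _).1 hu).1 hex h
  unfold OneShared.phi
  simp only [hey, hex, if_true, if_false]
  rw [dif_pos (dom_S3 hu hex)]

/-- (S3) the new `I`-trace `g = Φ_c(x_I)` lies in `d \ T`: `g ⊆ R`, `g + e ∈ B`, `σ g ∉ B⁰|_R`, `g ∉ T = σA`. [this work] -/
theorem img_S3 {x y : Finset ι} (hu : ((x, y), 0) ∈ ThreePartition.negUnitSetF S.B S.C) (hex : S.e ∈ x) :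
    ((S.dataI y).Φc ⟨x ∩ S.I, dom_S3 hu hex⟩ : Finset ι) ⊆ S.I \ (y ∩ S.I) ∧
      ((S.dataI y).Φc ⟨x ∩ S.I, dom_S3 hu hex⟩ : Finset ι) ∈ secHigh (S.I \ (y ∩ S.I)) S.e S.B ∧
      (S.I \ (y ∩ S.I)) \ ((S.dataI y).Φc ⟨x ∩ S.I, dom_S3 hu hex⟩ : Finset ι) ∉ secLow (S.I \ (y ∩ S.I)) S.B ∧
      ((S.dataI y).Φc ⟨x ∩ S.I, dom_S3 hu hex⟩ : Finset ι) ∉ (S.dataI y).A.image (fun t => (S.I \ (y ∩ S.I)) \ t) := by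
  have hPR : ∀ s ∈ secLow (S.I \ (y ∩ S.I)) S.B, s ⊆ S.I \ (y ∩ S.I) := fun s hs => (mem_secLow.1 hs).1
  have hgmem := ((S.dataI y).Φc ⟨x ∩ S.I, dom_S3 hu hex⟩).2
  rw [mem_sdiff, mem_sdiff, mem_image_ground_sdiff _ hPR] at hgmem
  obtain ⟨⟨hgQ, hgn⟩, hgT⟩ := hgmem
  have hgR : ((S.dataI y).Φc ⟨x ∩ S.I, dom_S3 hu hex⟩ : Finset ι) ⊆ S.I \ (y ∩ S.I) := (mem_secHigh.1 hgQ).1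
  exact ⟨hgR, hgQ, fun h => hgn ⟨hgR, h⟩, hgT⟩

/-- **Class (S3)**: `φ` sends a `T1⁻` unit with `e ∈ x` to the `T1⁺` unit at `(Φ_c(x_I) ∪ x_J + e, y)`. [this work] -/
theorem phi_adm_S3 {x y : Finset ι} (hu : ((x, y), 0) ∈ ThreePartition.negUnitSetF S.B S.C) (hex : S.e ∈ x) :
    S.phi ((x, y), 0) ∈ ThreePartition.posUnitSetF S.B S.C ∧ x ⊆ (S.phi ((x, y), 0)).1.1 ∧ y ⊆ (S.phi ((x, y), 0)).1.2 := by
  obtain ⟨hgR, hgQ, hgn, -⟩ := img_S3 hu hex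
  have hgdom : x ∩ S.I ⊆ ((S.dataI y).Φc ⟨x ∩ S.I, dom_S3 hu hex⟩ : Finset ι) :=
    (S.dataI y).hΦc ⟨x ∩ S.I, dom_S3 hu hex⟩
  rw [phi_eq_S3 hu hex]
  set g := ((S.dataI y).Φc ⟨x ∩ S.I, dom_S3 hu hex⟩ : Finset ι) with hg
  rw [mem_negUnitSetF_iff] at hu
  obtain ⟨hxy, h⟩ := hu
  simp only at hxy h
  rcases h with ⟨-, ⟨hxC, -⟩, -⟩ | ⟨h1, -⟩ | ⟨h2, -⟩
  rotate_left
  · exact absurd h1 (by norm_num)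
  · exact absurd h2 (by norm_num)
  have hgI : g ⊆ S.I := hgR.trans sdiff_subset
  have hex' : S.e ∈ (x \ S.I) ∪ g := (nf_mem_iff S.heI hgI).2 hex
  have hdisj' : Disjoint ((x \ S.I) ∪ g) y := nf_disjoint hxy hgR
  have hez' : S.e ∉ (((x \ S.I) ∪ g) ∪ y)ᶜ := by rw [mem_compl, not_not, mem_union]; exact Or.inl hex'
  rw [mem_posUnitSetF_iff]
  refine ⟨⟨hdisj', Or.inl ⟨rfl, ⟨?_, ?_⟩, ?_⟩⟩, nf_subset hgdom, subset_rfl⟩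
  · -- `x' ∈ B` (`e ∈ x'`, upper section)
    refine (mem_B_iff_secHigh (R := S.I \ (y ∩ S.I)) hex' ?_).2 ?_
    · rw [nf_inter hgI]; exact hgR
    · rw [nf_inter hgI]; exact hgQ
  · -- `x' ∈ C`: same `J`-trace, `e` on both
    have hxJ : x ∩ S.J ∈ secHigh (S.J \ (y ∩ S.J)) S.e S.C :=
      (mem_C_iff_secHigh hex (inter_subset_sdiff_inter hxy S.J)).1 hxC
    refine (mem_C_iff_secHigh hex' (inter_subset_sdiff_inter hdisj' S.J)).2 ?_
    rw [nf_inter_other S.hIJ hgI]; exact hxJ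
  · -- `z' ∉ B`
    intro hz'B
    have hz'I : (((x \ S.I) ∪ g) ∪ y)ᶜ ∩ S.I = (S.I \ (y ∩ S.I)) \ g := nf_compl_inter hgI
    have h1 := (mem_B_iff_secLow hez' (hz'I ▸ sdiff_subset)).1 hz'B
    rw [hz'I] at h1
    exact hgn h1

/-- (S3) signature of the target: `3`. [this work] -/
theorem sig_phi_S3 {x y : Finset ι} (hu : ((x, y), 0) ∈ ThreePartition.negUnitSetF S.B S.C) (hex : S.e ∈ x) :
    S.sig (S.phi ((x, y), 0)) = 3 := by
  obtain ⟨hgR, -, -, hgT⟩ := img_S3 hu hex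
  have hgI := hgR.trans sdiff_subset
  have hey : S.e ∉ y := fun h => disjoint_left.1 ((mem_negUnitSetF_iff _ _ _).1 hu).1 hex h
  rw [phi_eq_S3 hu hex]
  refine S.sig_eq_3 rfl hey ((nf_mem_iff S.heI hgI).2 hex) ?_
  show ((x \ S.I) ∪ _) ∩ S.I ∉ _
  rw [nf_inter hgI]; exact hgT

/-- (S3) `φ` is injective on the class. [this work] -/
theorem inj_S3 {x₁ y₁ x₂ y₂ : Finset ι} (hu₁ : ((x₁, y₁), 0) ∈ ThreePartition.negUnitSetF S.B S.C) (hex₁ : S.e ∈ x₁)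
    (hu₂ : ((x₂, y₂), 0) ∈ ThreePartition.negUnitSetF S.B S.C) (hex₂ : S.e ∈ x₂)
    (h : S.phi ((x₁, y₁), 0) = S.phi ((x₂, y₂), 0)) : ((x₁, y₁), 0) = ((x₂, y₂), 0) := by
  rw [phi_eq_S3 hu₁ hex₁, phi_eq_S3 hu₂ hex₂] at h
  simp only [Prod.mk.injEq, and_true] at h
  obtain ⟨hx, rfl⟩ := h
  have hg₁I := (img_S3 hu₁ hex₁).1.trans sdiff_subset
  have hg₂I := (img_S3 hu₂ hex₂).1.trans sdiff_subset
  have hI : x₁ ∩ S.I = x₂ ∩ S.I :=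
    congrArg Subtype.val ((S.dataI _).Φc.injective (Subtype.ext (nf_eq_nf_inter hg₁I hg₂I hx)))
  have hJ : x₁ ∩ S.J = x₂ ∩ S.J := nf_eq_nf_inter_other S.hIJ hg₁I hg₂I hx
  rw [part_eq_of_traces (s := x₁) (s' := x₂) ⟨fun _ => hex₂, fun _ => hex₁⟩ hI hJ]

/-! ### Class (S5): `T2⁻` with `e ∈ x` -/

/-- (S5) domain: `x_J ∈ σP_w \ Q_w`. [this work] -/
theorem dom_S5 {x y : Finset ι} (hu : ((x, y), 1) ∈ ThreePartition.negUnitSetF S.B S.C) (hex : S.e ∈ x) :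
    x ∩ S.J ∈ (secLow (S.J \ (y ∩ S.J)) S.C).image (fun t => (S.J \ (y ∩ S.J)) \ t) \ secHigh (S.J \ (y ∩ S.J)) S.e S.C := by
  rw [mem_negUnitSetF_iff] at hu
  obtain ⟨hxy, h⟩ := hu
  simp only at hxy h
  rcases h with ⟨h0, -⟩ | ⟨-, ⟨-, hxC⟩, hzC⟩ | ⟨h2, -⟩
  · exact absurd h0 (by norm_num)
  rotate_left
  · exact absurd h2 (by norm_num)
  have hey : S.e ∉ y := fun h => disjoint_left.1 hxy hex h
  have hxJR : x ∩ S.J ⊆ S.J \ (y ∩ S.J) := inter_subset_sdiff_inter hxy S.J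
  have hzJ : (x ∪ y)ᶜ ∩ S.J = (S.J \ (y ∩ S.J)) \ (x ∩ S.J) := compl_union_inter_eq x y S.J
  have hez : S.e ∉ (x ∪ y)ᶜ := by rw [mem_compl, not_not, mem_union]; exact Or.inl hex
  have hPR : ∀ s ∈ secLow (S.J \ (y ∩ S.J)) S.C, s ⊆ S.J \ (y ∩ S.J) := fun s hs => (mem_secLow.1 hs).1
  rw [mem_sdiff, mem_image_ground_sdiff _ hPR]
  refine ⟨⟨hxJR, ?_⟩, fun h => hxC ((mem_C_iff_secHigh hex hxJR).2 h)⟩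
  rw [← hzJ]
  exact (mem_C_iff_secLow hez (hzJ ▸ sdiff_subset)).1 hzC

/-- (S5) the value of `φ`. [this work] -/
theorem phi_eq_S5 {x y : Finset ι} (hu : ((x, y), 1) ∈ ThreePartition.negUnitSetF S.B S.C) (hex : S.e ∈ x) :
    S.phi ((x, y), 1) = (((x \ S.J) ∪ ((S.dataJ (y ∩ S.J)).Φc ⟨x ∩ S.J, dom_S5 hu hex⟩ : Finset ι), y), 1) := by
  have hey : S.e ∉ y := fun h => disjoint_left.1 ((mem_negUnitSetF_iff _ _ _).1 hu).1 hex h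
  unfold OneShared.phi
  simp only [hey, hex, if_true, if_false, Nat.one_ne_zero]
  rw [dif_pos (dom_S5 hu hex)]

/-- (S5) the new `J`-trace `g = Φ′_w(x_J)` lies in `d′_w \ T_w`. [this work] -/
theorem img_S5 {x y : Finset ι} (hu : ((x, y), 1) ∈ ThreePartition.negUnitSetF S.B S.C) (hex : S.e ∈ x) :
    ((S.dataJ (y ∩ S.J)).Φc ⟨x ∩ S.J, dom_S5 hu hex⟩ : Finset ι) ⊆ S.J \ (y ∩ S.J) ∧
      ((S.dataJ (y ∩ S.J)).Φc ⟨x ∩ S.J, dom_S5 hu hex⟩ : Finset ι) ∈ secHigh (S.J \ (y ∩ S.J)) S.e S.C ∧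
      (S.J \ (y ∩ S.J)) \ ((S.dataJ (y ∩ S.J)).Φc ⟨x ∩ S.J, dom_S5 hu hex⟩ : Finset ι) ∉ secLow (S.J \ (y ∩ S.J)) S.C ∧
      ((S.dataJ (y ∩ S.J)).Φc ⟨x ∩ S.J, dom_S5 hu hex⟩ : Finset ι) ∉
        (S.dataJ (y ∩ S.J)).A.image (fun t => (S.J \ (y ∩ S.J)) \ t) := by
  have hPR : ∀ s ∈ secLow (S.J \ (y ∩ S.J)) S.C, s ⊆ S.J \ (y ∩ S.J) := fun s hs => (mem_secLow.1 hs).1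
  have hgmem := ((S.dataJ (y ∩ S.J)).Φc ⟨x ∩ S.J, dom_S5 hu hex⟩).2
  rw [mem_sdiff, mem_sdiff, mem_image_ground_sdiff _ hPR] at hgmem
  obtain ⟨⟨hgQ, hgn⟩, hgT⟩ := hgmem
  have hgR : ((S.dataJ (y ∩ S.J)).Φc ⟨x ∩ S.J, dom_S5 hu hex⟩ : Finset ι) ⊆ S.J \ (y ∩ S.J) := (mem_secHigh.1 hgQ).1
  exact ⟨hgR, hgQ, fun h => hgn ⟨hgR, h⟩, hgT⟩

/-- **Class (S5)**: `φ` sends a `T2⁻` unit with `e ∈ x` to the `T2⁺` unit at `(x_I ∪ Φ′_w(x_J) + e, y)`. [this work] -/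
theorem phi_adm_S5 {x y : Finset ι} (hu : ((x, y), 1) ∈ ThreePartition.negUnitSetF S.B S.C) (hex : S.e ∈ x) :
    S.phi ((x, y), 1) ∈ ThreePartition.posUnitSetF S.B S.C ∧ x ⊆ (S.phi ((x, y), 1)).1.1 ∧ y ⊆ (S.phi ((x, y), 1)).1.2 := by
  obtain ⟨hgR, hgQ, hgn, -⟩ := img_S5 hu hex
  have hgdom : x ∩ S.J ⊆ ((S.dataJ (y ∩ S.J)).Φc ⟨x ∩ S.J, dom_S5 hu hex⟩ : Finset ι) :=
    (S.dataJ (y ∩ S.J)).hΦc ⟨x ∩ S.J, dom_S5 hu hex⟩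
  rw [phi_eq_S5 hu hex]
  set g := ((S.dataJ (y ∩ S.J)).Φc ⟨x ∩ S.J, dom_S5 hu hex⟩ : Finset ι) with hg
  rw [mem_negUnitSetF_iff] at hu
  obtain ⟨hxy, h⟩ := hu
  simp only at hxy h
  rcases h with ⟨h0, -⟩ | ⟨-, ⟨hxB, -⟩, -⟩ | ⟨h2, -⟩
  · exact absurd h0 (by norm_num)
  rotate_left
  · exact absurd h2 (by norm_num)
  have hgJ : g ⊆ S.J := hgR.trans sdiff_subset
  have hex' : S.e ∈ (x \ S.J) ∪ g := (nf_mem_iff S.heJ hgJ).2 hex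
  have hdisj' : Disjoint ((x \ S.J) ∪ g) y := nf_disjoint hxy hgR
  have hez' : S.e ∉ (((x \ S.J) ∪ g) ∪ y)ᶜ := by rw [mem_compl, not_not, mem_union]; exact Or.inl hex'
  rw [mem_posUnitSetF_iff]
  refine ⟨⟨hdisj', Or.inr (Or.inl ⟨rfl, ⟨?_, ?_⟩, ?_⟩)⟩, nf_subset hgdom, subset_rfl⟩
  · have hxI : x ∩ S.I ∈ secHigh (S.I \ (y ∩ S.I)) S.e S.B :=
      (mem_B_iff_secHigh hex (inter_subset_sdiff_inter hxy S.I)).1 hxB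
    refine (mem_B_iff_secHigh hex' (inter_subset_sdiff_inter hdisj' S.I)).2 ?_
    rw [nf_inter_other S.hIJ.symm hgJ]; exact hxI
  · refine (mem_C_iff_secHigh (R := S.J \ (y ∩ S.J)) hex' ?_).2 ?_
    · rw [nf_inter hgJ]; exact hgR
    · rw [nf_inter hgJ]; exact hgQ
  · intro hz'C
    have hz'J : (((x \ S.J) ∪ g) ∪ y)ᶜ ∩ S.J = (S.J \ (y ∩ S.J)) \ g := nf_compl_inter hgJ
    have h1 := (mem_C_iff_secLow hez' (hz'J ▸ sdiff_subset)).1 hz'C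
    rw [hz'J] at h1
    exact hgn h1

/-- (S5) signature of the target: `7`. [this work] -/
theorem sig_phi_S5 {x y : Finset ι} (hu : ((x, y), 1) ∈ ThreePartition.negUnitSetF S.B S.C) (hex : S.e ∈ x) :
    S.sig (S.phi ((x, y), 1)) = 7 := by
  obtain ⟨hgR, -, -, hgT⟩ := img_S5 hu hex
  have hgJ := hgR.trans sdiff_subset
  have hey : S.e ∉ y := fun h => disjoint_left.1 ((mem_negUnitSetF_iff _ _ _).1 hu).1 hex h
  rw [phi_eq_S5 hu hex]
  refine S.sig_eq_7 rfl hey ((nf_mem_iff S.heJ hgJ).2 hex) ?_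
  show ((x \ S.J) ∪ _) ∩ S.J ∉ _
  rw [nf_inter hgJ]; exact hgT

/-- (S5) `φ` is injective on the class. [this work] -/
theorem inj_S5 {x₁ y₁ x₂ y₂ : Finset ι} (hu₁ : ((x₁, y₁), 1) ∈ ThreePartition.negUnitSetF S.B S.C) (hex₁ : S.e ∈ x₁)
    (hu₂ : ((x₂, y₂), 1) ∈ ThreePartition.negUnitSetF S.B S.C) (hex₂ : S.e ∈ x₂)
    (h : S.phi ((x₁, y₁), 1) = S.phi ((x₂, y₂), 1)) : ((x₁, y₁), 1) = ((x₂, y₂), 1) := by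
  rw [phi_eq_S5 hu₁ hex₁, phi_eq_S5 hu₂ hex₂] at h
  simp only [Prod.mk.injEq, and_true] at h
  obtain ⟨hx, rfl⟩ := h
  have hg₁J := (img_S5 hu₁ hex₁).1.trans sdiff_subset
  have hg₂J := (img_S5 hu₂ hex₂).1.trans sdiff_subset
  have hJ : x₁ ∩ S.J = x₂ ∩ S.J :=
    congrArg Subtype.val ((S.dataJ _).Φc.injective (Subtype.ext (nf_eq_nf_inter hg₁J hg₂J hx)))
  have hI : x₁ ∩ S.I = x₂ ∩ S.I := nf_eq_nf_inter_other S.hIJ.symm hg₁J hg₂J hx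
  rw [part_eq_of_traces (s := x₁) (s' := x₂) ⟨fun _ => hex₂, fun _ => hex₁⟩ hI hJ]

end OneShared

end SahiFComb.Shift

end Summit.CriticalPhenomena.PercolationContinuityZ3.Theorems
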